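import Summits.ABC.ABC.Theorems.TwistAmplificationSharpModerateLawCuspTransferCone
import Summits.ABC.ABC.Theorems.TwistAmplificationSharpModerateLawSyzygyTransferCone
import Summits.ABC.ABC.Theorems.TwistAmplificationSharpModerateLawLatticeHalf
import Summits.ABC.ABC.Theorems.TwistAmplificationSharpModerateLawFieldSum
import Summits.ABC.ABC.Theorems.TwistAmplificationSharpModerateLawFewDeepOfLattice

/-!
# Line `syzygy-lattice-half-deep-few-primes` — registered skeleton v7 (lead) for crux `SharpModerateLaw` (stmt-ABC-1975)

Lead `prover-line-stmt-ABC-1975-0`, 2026-08-16.  Everything provable on this line has LANDED and is imported above: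

* `stub_cuspTransfer : CuspShellLaw → SharpModerateLaw` (p74724) and its cone form `cuspTransferCone` (p76583);
* `stub_syzygyTransfer : IndexFormShellLaw → CuspShellLaw` (p75600) and its cone form `syzygyTransferCone`, with the cone
  split `indexFormShellLawCone_of_split` (p76848);
* `stub_latticeHalf : LatticeHalf` (Kane's lattice half uniformly in a maximal cubic form; 5-file chain);
* `stub_fewDeepOfLattice : LatticeHalf → FieldSum → FewDeepLaw` (3-file chain);
* `stub_fieldSum : btt_uniformity_sqDvd → FieldSum` (conditional on ONE named Literature fact; chain incl. two Literature files).

The composition below is a closed term over exactly TWO open registered stubs: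
* `stub_uniformity : Literature.NumberTheory.CubicFields.btt_uniformity_sqDvd` — discharge of the Bhargava–Taniguchi–Thorne
  2023 Prop. 4.5 uniformity estimate (a published theorem; literature-prover obligation, not part of this line's mathematics);
* `stub_spreadCensusCone : SpreadLawCone` — the crux's OPEN CORE in its honest minimal (cone-restricted) form: the dyadic law
  for the spread population of index-form data on the scales `X³ ≤ 2Y ≤ 2·186624·X^σ` only (`…ConeDefs.lean`); the previously
  registered two-parameter `SpreadLaw` implies it (`spreadLaw_implies_cone`, landed) and is not needed by the crux.
-/

noncomputable section

namespace Summit.ABC.ABC.Theorems.SharpModerateLaw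

/-- **stub_uniformity** — discharge of the named fact `btt_uniformity_sqDvd` (BTT 2023 Prop. 4.5: for squarefree `q`, the
number of cubic rings `R` with `q² ∣ Disc R`, `0 < ±Disc R < X` is `≪ 6^{ω(q)} X/q²`). OPEN (literature-prover obligation). -/
theorem stub_uniformity : Literature.NumberTheory.CubicFields.btt_uniformity_sqDvd := by
  sorry

/-- **stub_spreadCensusCone** `SpreadLawCone` — the OPEN CORE of the crux on this line (cone-restricted spread law):
`∀ σ > 6, ∀ ε > 0, ∃ C, ∀ X Y ≥ 1, X³ ≤ 2Y → Y ≤ 186624·X^σ → totalCount (¬FewDeep) X Y ≤ C (XY)^ε (X·Y^{-1/6} + 1)`.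
Equivalent in strength to the crux on the spread population; no engine in print (candidates: Kane's conic half in maximal cubic
orders + Heath-Brown's sharp conic bound + Bhargava mean 2-torsion + a census of hit shapes; or dispersion over deep moduli at
level 6/5).  See the lead's analysis attached to the item. -/
theorem stub_spreadCensusCone : SpreadLawCone := by
  sorry

/-- **Composition (the skeleton theorem, v7).** The crux BY NAME as a closed term: cone cusp transfer ∘ cone dictionary step ∘
cone split of (few-deep law from the lattice half and the field sum, the latter from the BTT uniformity fact) and the cone spread law. -/
theorem SharpModerateLaw_of : Summit.ABC.ABC.Theses.TwistAmplification.SharpModerateLaw :=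
  cuspTransferCone
    (syzygyTransferCone
      (indexFormShellLawCone_of_split
        (fewDeepLawCone_of_fewDeepLaw (stub_fewDeepOfLattice stub_latticeHalf (stub_fieldSum stub_uniformity)))
        stub_spreadCensusCone))

end Summit.ABC.ABC.Theorems.SharpModerateLaw

end
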